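import Summits.CriticalPhenomena.SAWScalingLimit.Theorems.SAWDevelopingMapHexConjectureReflexWedgeGeometryCoord

/-!
# Reflex-wedge geometry, part B: the truncated `300°` wedge `W_N` is simply connected

Support file for the crux `HexConjecture` (stmt-CriticalPhenomena-0808), line
`marginal-reflex-wedge-cauchy-kernel`, stub `stub_reflexWedgeGeometry`, conjunct (i):
**`reflexWedge_simplyConnected`** — for `N ≥ 1` the domain `W_N = {v : ‖c_v‖ < N, arg c_v ∉ [0, π/3]}`
has a connected complement in the honeycomb lattice (`hexDomainSimplyConnected`, "simply connected" in the
sense of Duminil-Copin–Smirnov 2012, §2).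

Proof (cell coordinates `((a, b); t)`, file `…ReflexWedgeGeometryCoord`): the complement is
`{‖c‖ ≥ N} ∪ {a ≥ 0 ∧ b ≥ 0}`, and `9‖c‖² = A² + AB + B²` with `A = 3a + t + 1`, `B = 3b + t + 1`. Every vertex
of the complement is joined INSIDE the complement to the frame `{|a| ≥ K} ∪ {|b| ≥ K}` (`K = 2⌈N⌉`, on which
`A² + AB + B² ≥ 3K² ≥ 9N²`): in the quadrant along its row to the right; below the axis and right of the
`120°` line (`b < 0 ≤ a`) along the anti-diagonal down-right, in the third quadrant (`a, b < 0`) down its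
column, and above the axis left of the `60°` line (`a < 0 ≤ b`) along the anti-diagonal up-left — along each
of these zigzags `‖c‖` is non-decreasing (the honeycomb moves change `A² + AB + B²` by `3A + 3B + 3`, `3 - 3A`,
`3 - 3B` and their negatives), so the path stays in `{‖c‖ ≥ N}`. The frame is a union of full rows and full
columns of the complement, each row meeting each column, hence joined to the hub `((K, K); 0)`. Paths are
`Literature.Probability.Percolation.PathIn` chains (as in `HexDomainSingleton.lean`), turned into
preconnectedness of the induced subgraph by `preconnected_induce_of_forall_pathIn`. Folklore; no named
fact is used.
-/

open scoped BigOperators Classical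
open Literature.Probability.LatticeModels Literature.Probability.RandomPlanarGeometry
  Literature.Probability.RandomPlanarGeometry.SAW Literature.Probability.Percolation

namespace Summit.CriticalPhenomena.SAWScalingLimit.Theorems.HexConjecture.MarginalWedge.ReflexGeometry

variable {S : Set HexVertex}

/-! ### Rows and columns inside a set -/

/-- A rightward row run inside `S`: `((a,b);0) ∼ ((a,b);1) ∼ ((a+1,b);0) ∼ ⋯ ∼ ((a+n,b);0)`. [folklore] -/
theorem pathIn_row (a b : ℤ) (n : ℕ)
    (h : ∀ i : ℕ, i ≤ n → ∀ t : Fin 2, (((![a + i, b] : Site 2), t) : HexVertex) ∈ S) :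
    PathIn hexGraph S (((![a, b] : Site 2), (0 : Fin 2)) : HexVertex) ((![a + n, b] : Site 2), (0 : Fin 2)) := by
  induction n with
  | zero => simpa using PathIn.refl (h 0 le_rfl 0)
  | succ n ih =>
    have p := ih fun i hi t => h i (by omega) t
    have e : a + (n : ℤ) + 1 = a + ((n + 1 : ℕ) : ℤ) := by push_cast; ring
    have h2 := h (n + 1) le_rfl 0
    rw [← e] at h2 ⊢
    exact (p.tail (hexGraph_adj_up (a + n) b) (h n (by omega) 1)).tail (hexGraph_adj_e0 (a + n) b) h2

/-- An upward column run inside `S`: `((a,b);0) ∼ ((a,b);1) ∼ ((a,b+1);0) ∼ ⋯ ∼ ((a,b+n);0)`. [folklore] -/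
theorem pathIn_col (a b : ℤ) (n : ℕ)
    (h : ∀ i : ℕ, i ≤ n → ∀ t : Fin 2, (((![a, b + i] : Site 2), t) : HexVertex) ∈ S) :
    PathIn hexGraph S (((![a, b] : Site 2), (0 : Fin 2)) : HexVertex) ((![a, b + n] : Site 2), (0 : Fin 2)) := by
  induction n with
  | zero => simpa using PathIn.refl (h 0 le_rfl 0)
  | succ n ih =>
    have p := ih fun i hi t => h i (by omega) t
    have e : b + (n : ℤ) + 1 = b + ((n + 1 : ℕ) : ℤ) := by push_cast; ring
    have h2 := h (n + 1) le_rfl 0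
    rw [← e] at h2 ⊢
    exact (p.tail (hexGraph_adj_up a (b + n)) (h n (by omega) 1)).tail (hexGraph_adj_e1 a (b + n)) h2

/-- A row run between two abscissae `a ≤ a'` of a row lying in `S`. [folklore] -/
theorem pathIn_row_of_le {a a' : ℤ} (b : ℤ) (haa' : a ≤ a')
    (h : ∀ (x : ℤ) (t : Fin 2), (((![x, b] : Site 2), t) : HexVertex) ∈ S) :
    PathIn hexGraph S (((![a, b] : Site 2), (0 : Fin 2)) : HexVertex) ((![a', b] : Site 2), (0 : Fin 2)) := by
  obtain ⟨n, rfl⟩ : ∃ n : ℕ, a' = a + n := ⟨(a' - a).toNat, by omega⟩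
  exact pathIn_row a b n fun i _ t => h _ t

/-- A row run between any two abscissae of a row lying in `S`. [folklore] -/
theorem pathIn_row_any (a a' b : ℤ) (h : ∀ (x : ℤ) (t : Fin 2), (((![x, b] : Site 2), t) : HexVertex) ∈ S) :
    PathIn hexGraph S (((![a, b] : Site 2), (0 : Fin 2)) : HexVertex) ((![a', b] : Site 2), (0 : Fin 2)) := by
  rcases le_or_gt a a' with hle | hlt
  · exact pathIn_row_of_le b hle h
  · exact (pathIn_row_of_le b hlt.le h).symm

/-- A column run between any two ordinates of a column lying in `S`. [folklore] -/
theorem pathIn_col_any (a b b' : ℤ) (h : ∀ (y : ℤ) (t : Fin 2), (((![a, y] : Site 2), t) : HexVertex) ∈ S) :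
    PathIn hexGraph S (((![a, b] : Site 2), (0 : Fin 2)) : HexVertex) ((![a, b'] : Site 2), (0 : Fin 2)) := by
  rcases le_or_gt b b' with hle | hlt
  · obtain ⟨n, rfl⟩ : ∃ n : ℕ, b' = b + n := ⟨(b' - b).toNat, by omega⟩
    exact pathIn_col a b n fun i _ t => h _ t
  · obtain ⟨n, rfl⟩ : ∃ n : ℕ, b = b' + n := ⟨(b - b').toNat, by omega⟩
    exact (pathIn_col a b' n fun i _ t => h _ t).symm

/-! ### The frame `{|a| ≥ K} ∪ {|b| ≥ K}` is joined to the hub `((K, K); 0)` -/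

/-- Every vertex of the frame is joined inside `S ⊇ frame` to the hub `((K,K);0)`: along its row or column
(entirely in the frame) to the column or row `K`, then along that. [folklore] -/
theorem pathIn_frame_hub (K : ℤ)
    (hS : ∀ (a b : ℤ) (t : Fin 2), (K ≤ |a| ∨ K ≤ |b|) → (((![a, b] : Site 2), t) : HexVertex) ∈ S)
    (a b : ℤ) (t : Fin 2) (hab : K ≤ |a| ∨ K ≤ |b|) :
    PathIn hexGraph S (((![a, b] : Site 2), t) : HexVertex) ((![K, K] : Site 2), (0 : Fin 2)) := by
  have hKK : K ≤ |K| := le_abs_self K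
  have p0 : PathIn hexGraph S (((![a, b] : Site 2), t) : HexVertex) ((![a, b] : Site 2), (0 : Fin 2)) := by
    fin_cases t
    · exact PathIn.refl (hS a b 0 hab)
    · exact PathIn.of_adj (hS a b 1 hab) (hS a b 0 hab) (hexGraph_adj_up a b).symm
  refine p0.trans ?_
  rcases hab with ha | hb
  · exact (pathIn_col_any a b K fun y t => hS a y t (Or.inl ha)).trans
      (pathIn_row_any a K K fun x t => hS x K t (Or.inr hKK))
  · exact (pathIn_row_any a K b fun x t => hS x b t (Or.inr hb)).trans
      (pathIn_col_any K b K fun y t => hS K y t (Or.inl hKK))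

/-! ### Monotone escapes to the frame -/

/-- `‖c‖` along the down-right anti-diagonal from an up-face `((a,b);0)`, `a ≥ 0 > b`: the down-faces. [folklore] -/
theorem norm_le_diagDR_one {a b : ℤ} (ha : 0 ≤ a) (hb : b < 0) (k : ℕ) :
    ‖hexCenter (((![a, b] : Site 2), (0 : Fin 2)) : HexVertex)‖ ≤
      ‖hexCenter (((![a + k, b - k - 1] : Site 2), (1 : Fin 2)) : HexVertex)‖ := by
  rw [norm_center_le_iff]
  have hk : (0 : ℤ) ≤ k := Int.natCast_nonneg k
  norm_num
  nlinarith [mul_nonneg hk hk, mul_nonneg hk ha, mul_nonneg hk (by omega : (0 : ℤ) ≤ -b - 1)]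

/-- `‖c‖` along the down-right anti-diagonal from an up-face `((a,b);0)`, `a ≥ 0 > b`: the up-faces. [folklore] -/
theorem norm_le_diagDR_zero {a b : ℤ} (ha : 0 ≤ a) (hb : b < 0) (k : ℕ) :
    ‖hexCenter (((![a, b] : Site 2), (0 : Fin 2)) : HexVertex)‖ ≤
      ‖hexCenter (((![a + k, b - k] : Site 2), (0 : Fin 2)) : HexVertex)‖ := by
  rw [norm_center_le_iff]
  have hk : (0 : ℤ) ≤ k := Int.natCast_nonneg k
  norm_num
  nlinarith [mul_nonneg hk hk, mul_nonneg hk ha, mul_nonneg hk (by omega : (0 : ℤ) ≤ -b - 1)]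

/-- The down-right anti-diagonal escape `((a,b);0) ∼ ((a,b-1);1) ∼ ((a+1,b-1);0) ∼ ⋯` from an up-face with
`a ≥ 0 > b` stays in `{‖c‖ ≥ R} ⊆ S`. [folklore] -/
theorem pathIn_diagDR {R : ℝ} (hS : ∀ (a b : ℤ) (t : Fin 2), R ≤ ‖hexCenter (((![a, b] : Site 2), t) : HexVertex)‖ →
      (((![a, b] : Site 2), t) : HexVertex) ∈ S)
    {a b : ℤ} (ha : 0 ≤ a) (hb : b < 0) (hR : R ≤ ‖hexCenter (((![a, b] : Site 2), (0 : Fin 2)) : HexVertex)‖)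
    (n : ℕ) :
    PathIn hexGraph S (((![a, b] : Site 2), (0 : Fin 2)) : HexVertex) ((![a + n, b - n] : Site 2), (0 : Fin 2)) := by
  have mem0 : ∀ k : ℕ, (((![a + k, b - k] : Site 2), (0 : Fin 2)) : HexVertex) ∈ S := fun k =>
    hS _ _ _ (hR.trans (norm_le_diagDR_zero ha hb k))
  have mem1 : ∀ k : ℕ, (((![a + k, b - k - 1] : Site 2), (1 : Fin 2)) : HexVertex) ∈ S := fun k =>
    hS _ _ _ (hR.trans (norm_le_diagDR_one ha hb k))
  induction n with
  | zero => simpa using PathIn.refl (mem0 0)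
  | succ n ih =>
    have e1 : a + (n : ℤ) + 1 = a + ((n + 1 : ℕ) : ℤ) := by push_cast; ring
    have e2 : b - (n : ℤ) - 1 = b - ((n + 1 : ℕ) : ℤ) := by push_cast; ring
    have h2 := mem0 (n + 1)
    rw [← e1, ← e2] at h2 ⊢
    exact (ih.tail (hexGraph_adj_dn (a + n) (b - n)) (mem1 n)).tail (hexGraph_adj_e0 (a + n) (b - n - 1)) h2

/-- `‖c‖` down a column from a down-face `((a,b);1)`, `a, b < 0`: the up-faces. [folklore] -/
theorem norm_le_colDown_zero {a b : ℤ} (ha : a < 0) (hb : b < 0) (k : ℕ) :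
    ‖hexCenter (((![a, b] : Site 2), (1 : Fin 2)) : HexVertex)‖ ≤
      ‖hexCenter (((![a, b - k] : Site 2), (0 : Fin 2)) : HexVertex)‖ := by
  rw [norm_center_le_iff]
  have hk : (0 : ℤ) ≤ k := Int.natCast_nonneg k
  norm_num
  nlinarith [mul_nonneg hk hk, mul_nonneg hk (by omega : (0 : ℤ) ≤ -a - 1),
    mul_nonneg hk (by omega : (0 : ℤ) ≤ -b - 1)]

/-- `‖c‖` down a column from a down-face `((a,b);1)`, `a, b < 0`: the down-faces. [folklore] -/
theorem norm_le_colDown_one {a b : ℤ} (ha : a < 0) (hb : b < 0) (k : ℕ) :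
    ‖hexCenter (((![a, b] : Site 2), (1 : Fin 2)) : HexVertex)‖ ≤
      ‖hexCenter (((![a, b - k] : Site 2), (1 : Fin 2)) : HexVertex)‖ := by
  rw [norm_center_le_iff]
  have hk : (0 : ℤ) ≤ k := Int.natCast_nonneg k
  norm_num
  nlinarith [mul_nonneg hk hk, mul_nonneg hk (by omega : (0 : ℤ) ≤ -a - 1),
    mul_nonneg hk (by omega : (0 : ℤ) ≤ -b - 1)]

/-- The column-down escape `((a,b);1) ∼ ((a,b);0) ∼ ((a,b-1);1) ∼ ⋯` from a down-face with `a, b < 0`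
stays in `{‖c‖ ≥ R} ⊆ S`. [folklore] -/
theorem pathIn_colDown {R : ℝ} (hS : ∀ (a b : ℤ) (t : Fin 2), R ≤ ‖hexCenter (((![a, b] : Site 2), t) : HexVertex)‖ →
      (((![a, b] : Site 2), t) : HexVertex) ∈ S)
    {a b : ℤ} (ha : a < 0) (hb : b < 0) (hR : R ≤ ‖hexCenter (((![a, b] : Site 2), (1 : Fin 2)) : HexVertex)‖)
    (n : ℕ) :
    PathIn hexGraph S (((![a, b] : Site 2), (1 : Fin 2)) : HexVertex) ((![a, b - n] : Site 2), (1 : Fin 2)) := by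
  have mem0 : ∀ k : ℕ, (((![a, b - k] : Site 2), (0 : Fin 2)) : HexVertex) ∈ S := fun k =>
    hS _ _ _ (hR.trans (norm_le_colDown_zero ha hb k))
  have mem1 : ∀ k : ℕ, (((![a, b - k] : Site 2), (1 : Fin 2)) : HexVertex) ∈ S := fun k =>
    hS _ _ _ (hR.trans (norm_le_colDown_one ha hb k))
  induction n with
  | zero => simpa using PathIn.refl (mem1 0)
  | succ n ih =>
    have e2 : b - (n : ℤ) - 1 = b - ((n + 1 : ℕ) : ℤ) := by push_cast; ring
    have h2 := mem1 (n + 1)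
    rw [← e2] at h2 ⊢
    exact (ih.tail (hexGraph_adj_up a (b - n)).symm (mem0 n)).tail (hexGraph_adj_dn a (b - n)) h2

/-- `‖c‖` along the up-left anti-diagonal from a down-face `((a,b);1)`, `a < 0 ≤ b`: the up-faces. [folklore] -/
theorem norm_le_diagUL_zero {a b : ℤ} (ha : a < 0) (hb : 0 ≤ b) (k : ℕ) :
    ‖hexCenter (((![a, b] : Site 2), (1 : Fin 2)) : HexVertex)‖ ≤
      ‖hexCenter (((![a - k, b + k + 1] : Site 2), (0 : Fin 2)) : HexVertex)‖ := by
  rw [norm_center_le_iff]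
  have hk : (0 : ℤ) ≤ k := Int.natCast_nonneg k
  norm_num
  nlinarith [mul_nonneg hk hk, mul_nonneg hk hb, mul_nonneg hk (by omega : (0 : ℤ) ≤ -a - 1)]

/-- `‖c‖` along the up-left anti-diagonal from a down-face `((a,b);1)`, `a < 0 ≤ b`: the down-faces. [folklore] -/
theorem norm_le_diagUL_one {a b : ℤ} (ha : a < 0) (hb : 0 ≤ b) (k : ℕ) :
    ‖hexCenter (((![a, b] : Site 2), (1 : Fin 2)) : HexVertex)‖ ≤
      ‖hexCenter (((![a - k, b + k] : Site 2), (1 : Fin 2)) : HexVertex)‖ := by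
  rw [norm_center_le_iff]
  have hk : (0 : ℤ) ≤ k := Int.natCast_nonneg k
  norm_num
  nlinarith [mul_nonneg hk hk, mul_nonneg hk hb, mul_nonneg hk (by omega : (0 : ℤ) ≤ -a - 1)]

/-- The up-left anti-diagonal escape `((a,b);1) ∼ ((a,b+1);0) ∼ ((a-1,b+1);1) ∼ ⋯` from a down-face with
`a < 0 ≤ b` stays in `{‖c‖ ≥ R} ⊆ S`. [folklore] -/
theorem pathIn_diagUL {R : ℝ} (hS : ∀ (a b : ℤ) (t : Fin 2), R ≤ ‖hexCenter (((![a, b] : Site 2), t) : HexVertex)‖ →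
      (((![a, b] : Site 2), t) : HexVertex) ∈ S)
    {a b : ℤ} (ha : a < 0) (hb : 0 ≤ b) (hR : R ≤ ‖hexCenter (((![a, b] : Site 2), (1 : Fin 2)) : HexVertex)‖)
    (n : ℕ) :
    PathIn hexGraph S (((![a, b] : Site 2), (1 : Fin 2)) : HexVertex) ((![a - n, b + n] : Site 2), (1 : Fin 2)) := by
  have mem0 : ∀ k : ℕ, (((![a - k, b + k + 1] : Site 2), (0 : Fin 2)) : HexVertex) ∈ S := fun k =>
    hS _ _ _ (hR.trans (norm_le_diagUL_zero ha hb k))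
  have mem1 : ∀ k : ℕ, (((![a - k, b + k] : Site 2), (1 : Fin 2)) : HexVertex) ∈ S := fun k =>
    hS _ _ _ (hR.trans (norm_le_diagUL_one ha hb k))
  induction n with
  | zero => simpa using PathIn.refl (mem1 0)
  | succ n ih =>
    have e1 : a - (n : ℤ) - 1 = a - ((n + 1 : ℕ) : ℤ) := by push_cast; ring
    have e2 : b + (n : ℤ) + 1 = b + ((n + 1 : ℕ) : ℤ) := by push_cast; ring
    have h2 := mem1 (n + 1)
    have hw : hexGraph.Adj (((![a - n, b + n + 1] : Site 2), (0 : Fin 2)) : HexVertex)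
        ((![a - n - 1, b + n + 1] : Site 2), (1 : Fin 2)) := by
      simpa using (hexGraph_adj_e0 (a - n - 1) (b + n + 1)).symm
    rw [← e1, ← e2] at h2 ⊢
    exact (ih.tail (hexGraph_adj_e1 (a - n) (b + n)) (mem0 n)).tail hw h2

/-! ### The frame lies beyond radius `N` -/

/-- On the frame `{|a| ≥ K} ∪ {|b| ≥ K}`, `K ≥ 2`, one has `A² + AB + B² ≥ 3K²` (`4(A² + AB + B²) =
(2A+B)² + 3B² = (2B+A)² + 3A²`, `|A| ≥ 3|a| - 2 ≥ 2K`). [folklore] -/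
theorem three_mul_sq_le_form {K a b : ℤ} (hK : 2 ≤ K) (t : Fin 2) (h : K ≤ |a| ∨ K ≤ |b|) :
    3 * K ^ 2 ≤ (3 * a + (t : ℕ) + 1) ^ 2 + (3 * a + (t : ℕ) + 1) * (3 * b + (t : ℕ) + 1) + (3 * b + (t : ℕ) + 1) ^ 2 := by
  have ht : (((t : ℕ) : ℤ)) = 0 ∨ (((t : ℕ) : ℤ)) = 1 := by fin_cases t <;> simp
  set τ : ℤ := ((t : ℕ) : ℤ) with hτ
  rcases h with ha | hb
  · rcases le_abs'.1 ha with ha | ha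
    · have hA : 3 * a + τ + 1 ≤ -(2 * K) := by rcases ht with h0 | h0 <;> rw [h0] <;> omega
      nlinarith [sq_nonneg (2 * (3 * b + τ + 1) + (3 * a + τ + 1)),
        mul_nonneg (by linarith : (0 : ℤ) ≤ -(2 * K) - (3 * a + τ + 1)) (by linarith : (0 : ℤ) ≤ 2 * K - (3 * a + τ + 1))]
    · have hA : 2 * K ≤ 3 * a + τ + 1 := by rcases ht with h0 | h0 <;> rw [h0] <;> omega
      nlinarith [sq_nonneg (2 * (3 * b + τ + 1) + (3 * a + τ + 1)),
        mul_nonneg (by linarith : (0 : ℤ) ≤ 3 * a + τ + 1 - 2 * K) (by linarith : (0 : ℤ) ≤ 3 * a + τ + 1 + 2 * K)]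
  · rcases le_abs'.1 hb with hb | hb
    · have hB : 3 * b + τ + 1 ≤ -(2 * K) := by rcases ht with h0 | h0 <;> rw [h0] <;> omega
      nlinarith [sq_nonneg (2 * (3 * a + τ + 1) + (3 * b + τ + 1)),
        mul_nonneg (by linarith : (0 : ℤ) ≤ -(2 * K) - (3 * b + τ + 1)) (by linarith : (0 : ℤ) ≤ 2 * K - (3 * b + τ + 1))]
    · have hB : 2 * K ≤ 3 * b + τ + 1 := by rcases ht with h0 | h0 <;> rw [h0] <;> omega
      nlinarith [sq_nonneg (2 * (3 * a + τ + 1) + (3 * b + τ + 1)),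
        mul_nonneg (by linarith : (0 : ℤ) ≤ 3 * b + τ + 1 - 2 * K) (by linarith : (0 : ℤ) ≤ 3 * b + τ + 1 + 2 * K)]

/-! ### Escapes from the four regions of the complement -/

section Escapes

variable {R : ℝ} (hS : ∀ (a b : ℤ) (t : Fin 2), R ≤ ‖hexCenter (((![a, b] : Site 2), t) : HexVertex)‖ →
  (((![a, b] : Site 2), t) : HexVertex) ∈ S)
include hS

/-- Escape from the third quadrant `a, b < 0` (beyond radius `R`) to a row `≤ -K`. [folklore] -/
theorem escape_sw {a b : ℤ} (ha : a < 0) (hb : b < 0) (t : Fin 2)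
    (hR : R ≤ ‖hexCenter (((![a, b] : Site 2), t) : HexVertex)‖) (K : ℤ) :
    ∃ (a' b' : ℤ) (t' : Fin 2), (K ≤ |a'| ∨ K ≤ |b'|) ∧
      PathIn hexGraph S (((![a, b] : Site 2), t) : HexVertex) ((![a', b'] : Site 2), t') := by
  obtain ⟨b₁, hb₁, hR₁, p₁⟩ : ∃ b₁ : ℤ, b₁ < 0 ∧ R ≤ ‖hexCenter (((![a, b₁] : Site 2), (1 : Fin 2)) : HexVertex)‖ ∧
      PathIn hexGraph S (((![a, b] : Site 2), t) : HexVertex) ((![a, b₁] : Site 2), (1 : Fin 2)) := by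
    rcases (by fin_cases t <;> simp : t = 0 ∨ t = 1) with rfl | rfl
    · have hle : ‖hexCenter (((![a, b] : Site 2), (0 : Fin 2)) : HexVertex)‖ ≤
          ‖hexCenter (((![a, b - 1] : Site 2), (1 : Fin 2)) : HexVertex)‖ := by
        rw [norm_center_le_iff]; norm_num; nlinarith
      exact ⟨b - 1, by omega, hR.trans hle, PathIn.of_adj (hS _ _ _ hR) (hS _ _ _ (hR.trans hle)) (hexGraph_adj_dn a b)⟩
    · exact ⟨b, hb, hR, PathIn.refl (hS _ _ _ hR)⟩
  obtain ⟨n, hn⟩ : ∃ n : ℕ, b₁ - n ≤ -K := ⟨(b₁ + K).toNat, by omega⟩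
  exact ⟨a, b₁ - n, 1, Or.inr (le_abs'.2 (Or.inl hn)), p₁.trans (pathIn_colDown hS ha hb₁ hR₁ n)⟩

/-- Escape from `a ≥ 0 > b` (beyond radius `R`) to a column `≥ K`. [folklore] -/
theorem escape_se {a b : ℤ} (ha : 0 ≤ a) (hb : b < 0) (t : Fin 2)
    (hR : R ≤ ‖hexCenter (((![a, b] : Site 2), t) : HexVertex)‖) (K : ℤ) :
    ∃ (a' b' : ℤ) (t' : Fin 2), (K ≤ |a'| ∨ K ≤ |b'|) ∧
      PathIn hexGraph S (((![a, b] : Site 2), t) : HexVertex) ((![a', b'] : Site 2), t') := by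
  obtain ⟨a₁, ha₁, hR₁, p₁⟩ : ∃ a₁ : ℤ, 0 ≤ a₁ ∧ R ≤ ‖hexCenter (((![a₁, b] : Site 2), (0 : Fin 2)) : HexVertex)‖ ∧
      PathIn hexGraph S (((![a, b] : Site 2), t) : HexVertex) ((![a₁, b] : Site 2), (0 : Fin 2)) := by
    rcases (by fin_cases t <;> simp : t = 0 ∨ t = 1) with rfl | rfl
    · exact ⟨a, ha, hR, PathIn.refl (hS _ _ _ hR)⟩
    · have hle : ‖hexCenter (((![a, b] : Site 2), (1 : Fin 2)) : HexVertex)‖ ≤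
          ‖hexCenter (((![a + 1, b] : Site 2), (0 : Fin 2)) : HexVertex)‖ := by
        rw [norm_center_le_iff]; norm_num; nlinarith
      exact ⟨a + 1, by omega, hR.trans hle, PathIn.of_adj (hS _ _ _ hR) (hS _ _ _ (hR.trans hle)) (hexGraph_adj_e0 a b)⟩
  obtain ⟨n, hn⟩ : ∃ n : ℕ, K ≤ a₁ + n := ⟨K.toNat, by omega⟩
  exact ⟨a₁ + n, b - n, 0, Or.inl (hn.trans (le_abs_self _)), p₁.trans (pathIn_diagDR hS ha₁ hb hR₁ n)⟩

/-- Escape from `a < 0 ≤ b` (beyond radius `R`) to a row `≥ K`. [folklore] -/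
theorem escape_nw {a b : ℤ} (ha : a < 0) (hb : 0 ≤ b) (t : Fin 2)
    (hR : R ≤ ‖hexCenter (((![a, b] : Site 2), t) : HexVertex)‖) (K : ℤ) :
    ∃ (a' b' : ℤ) (t' : Fin 2), (K ≤ |a'| ∨ K ≤ |b'|) ∧
      PathIn hexGraph S (((![a, b] : Site 2), t) : HexVertex) ((![a', b'] : Site 2), t') := by
  obtain ⟨a₁, ha₁, hR₁, p₁⟩ : ∃ a₁ : ℤ, a₁ < 0 ∧ R ≤ ‖hexCenter (((![a₁, b] : Site 2), (1 : Fin 2)) : HexVertex)‖ ∧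
      PathIn hexGraph S (((![a, b] : Site 2), t) : HexVertex) ((![a₁, b] : Site 2), (1 : Fin 2)) := by
    rcases (by fin_cases t <;> simp : t = 0 ∨ t = 1) with rfl | rfl
    · have hle : ‖hexCenter (((![a, b] : Site 2), (0 : Fin 2)) : HexVertex)‖ ≤
          ‖hexCenter (((![a - 1, b] : Site 2), (1 : Fin 2)) : HexVertex)‖ := by
        rw [norm_center_le_iff]; norm_num; nlinarith
      have hw : hexGraph.Adj (((![a, b] : Site 2), (0 : Fin 2)) : HexVertex) ((![a - 1, b] : Site 2), (1 : Fin 2)) := by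
        simpa using (hexGraph_adj_e0 (a - 1) b).symm
      exact ⟨a - 1, by omega, hR.trans hle, PathIn.of_adj (hS _ _ _ hR) (hS _ _ _ (hR.trans hle)) hw⟩
    · exact ⟨a, ha, hR, PathIn.refl (hS _ _ _ hR)⟩
  obtain ⟨n, hn⟩ : ∃ n : ℕ, K ≤ b + n := ⟨K.toNat, by omega⟩
  exact ⟨a₁ - n, b + n, 1, Or.inr (hn.trans (le_abs_self _)), p₁.trans (pathIn_diagUL hS ha₁ hb hR₁ n)⟩

end Escapes

/-- Escape from the quadrant `a, b ≥ 0` (all of which lies in `S`) to a column `≥ K`. [folklore] -/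
theorem escape_ne (hS : ∀ (a b : ℤ) (t : Fin 2), 0 ≤ a → 0 ≤ b → (((![a, b] : Site 2), t) : HexVertex) ∈ S)
    {a b : ℤ} (ha : 0 ≤ a) (hb : 0 ≤ b) (t : Fin 2) (K : ℤ) :
    ∃ (a' b' : ℤ) (t' : Fin 2), (K ≤ |a'| ∨ K ≤ |b'|) ∧
      PathIn hexGraph S (((![a, b] : Site 2), t) : HexVertex) ((![a', b'] : Site 2), t') := by
  have p0 : PathIn hexGraph S (((![a, b] : Site 2), t) : HexVertex) ((![a, b] : Site 2), (0 : Fin 2)) := by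
    fin_cases t
    · exact PathIn.refl (hS a b 0 ha hb)
    · exact PathIn.of_adj (hS a b 1 ha hb) (hS a b 0 ha hb) (hexGraph_adj_up a b).symm
  obtain ⟨n, hn⟩ : ∃ n : ℕ, K ≤ a + n := ⟨K.toNat, by omega⟩
  exact ⟨a + n, b, 0, Or.inl (hn.trans (le_abs_self _)),
    p0.trans (pathIn_row a b n fun i _ t' => hS _ _ t' (by omega) hb)⟩

/-! ### Simple connectivity -/

/-- **`W_N` is simply connected** (`N ≥ 1`): the complement of the truncated `300°` wedge in the honeycomb
lattice is connected. [folklore] -/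
theorem reflexWedge_simplyConnected : ∀ (Λ : Finset HexVertex) (N : ℝ), 1 ≤ N → IsReflexWedgeTruncation Λ N → hexDomainSimplyConnected Λ := by
  intro Λ N hN hW
  have hN0 : (0 : ℝ) ≤ N := by linarith
  set S : Set HexVertex := ((↑Λ : Set HexVertex))ᶜ with hSdef
  -- membership in the complement, in coordinates
  have hmem : ∀ (a b : ℤ) (t : Fin 2), (((![a, b] : Site 2), t) : HexVertex) ∈ S ↔
      N ≤ ‖hexCenter (((![a, b] : Site 2), t) : HexVertex)‖ ∨ (0 ≤ a ∧ 0 ≤ b) := by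
    intro a b t
    rw [hSdef, Set.mem_compl_iff, Finset.mem_coe, not_mem_wedge_iff hW]
    simp
  have hfar : ∀ (a b : ℤ) (t : Fin 2), N ≤ ‖hexCenter (((![a, b] : Site 2), t) : HexVertex)‖ →
      (((![a, b] : Site 2), t) : HexVertex) ∈ S := fun a b t h => (hmem a b t).2 (Or.inl h)
  have hquad : ∀ (a b : ℤ) (t : Fin 2), 0 ≤ a → 0 ≤ b → (((![a, b] : Site 2), t) : HexVertex) ∈ S :=
    fun a b t ha hb => (hmem a b t).2 (Or.inr ⟨ha, hb⟩)
  -- the frame `{|a| ≥ K} ∪ {|b| ≥ K}`, `K = 2⌈N⌉`, lies in `{‖c‖ ≥ N} ⊆ S`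
  set K : ℤ := 2 * (⌈N⌉₊ : ℕ) with hKdef
  have hK2 : 2 ≤ K := by
    have : 1 ≤ ⌈N⌉₊ := Nat.one_le_ceil_iff.2 (by linarith)
    omega
  have hKN : 9 * N ^ 2 ≤ ((3 * K ^ 2 : ℤ) : ℝ) := by
    have h1 : N ≤ (⌈N⌉₊ : ℝ) := Nat.le_ceil N
    have h2 : (K : ℝ) = 2 * (⌈N⌉₊ : ℝ) := by rw [hKdef]; push_cast; ring
    push_cast
    rw [h2]
    nlinarith
  have hframe : ∀ (a b : ℤ) (t : Fin 2), (K ≤ |a| ∨ K ≤ |b|) → (((![a, b] : Site 2), t) : HexVertex) ∈ S :=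
    fun a b t h => hfar a b t (le_norm_center_of_le hN0 (hKN.trans (by exact_mod_cast three_mul_sq_le_form hK2 t h)))
  -- every vertex of the complement is joined, inside the complement, to the hub `((K, K); 0)`
  have key : ∀ z ∈ S, PathIn hexGraph S z (((![K, K] : Site 2), (0 : Fin 2)) : HexVertex) := by
    rintro ⟨x, t⟩ hz
    obtain ⟨a, b, rfl⟩ : ∃ a b : ℤ, x = ![a, b] := ⟨x 0, x 1, by funext j; fin_cases j <;> rfl⟩
    obtain ⟨a', b', t', hfr, p⟩ : ∃ (a' b' : ℤ) (t' : Fin 2), (K ≤ |a'| ∨ K ≤ |b'|) ∧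
        PathIn hexGraph S (((![a, b] : Site 2), t) : HexVertex) ((![a', b'] : Site 2), t') := by
      by_cases hq : 0 ≤ a ∧ 0 ≤ b
      · exact escape_ne hquad hq.1 hq.2 t K
      · have hR : N ≤ ‖hexCenter (((![a, b] : Site 2), t) : HexVertex)‖ := by
          have := (hmem a b t).1 hz
          tauto
        rcases lt_or_ge b 0 with hb | hb
        · rcases lt_or_ge a 0 with ha | ha
          · exact escape_sw hfar ha hb t hR K
          · exact escape_se hfar ha hb t hR K
        · have ha : a < 0 := by
            by_contra ha
            exact hq ⟨not_lt.1 ha, hb⟩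
          exact escape_nw hfar ha hb t hR K
    exact p.trans (pathIn_frame_hub K hframe a' b' t' hfr)
  exact preconnected_induce_of_forall_pathIn fun x hx y hy => (key x hx).trans (key y hy).symm

end Summit.CriticalPhenomena.SAWScalingLimit.Theorems.HexConjecture.MarginalWedge.ReflexGeometry
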